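import Literature.Geometry.Riemannian.BakryEmeryHeatFlow
import Literature.Geometry.Lorentzian.VolumeProofs
import Literature.Geometry.Lorentzian.DalembertianCompose
import Mathlib.Analysis.Calculus.BumpFunction.InnerProduct
import Mathlib.Analysis.Calculus.ContDiff.Deriv
import Mathlib.MeasureTheory.Integral.IntervalIntegral.FundThmCalculus
import HarnessLib

/-!
# From the `L¹`-Sobolev inequality to the level bound
# `C · vol{|u| ≥ t₂}^{1/q} · (t₂ − t₁) ≤ ∫_{t₁ < |u| < t₂} |∇u| dvol`

Topic `Geometry/Riemannian`. Let `(M, g)` be a smooth Riemannian manifold (Riemannian measure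
`μ = riemannianMeasure`) on which a **sharp `L¹`-Sobolev inequality** is known for smooth compactly
supported functions,

  `C (∫ |φ|^q dμ)^{1/q} ≤ ∫ |∇φ|_g dμ`        (`φ ∈ C_c^∞(M)`, `q > 0`),

as Brendle proves on complete `n`-manifolds with `Ric ≥ 0` and asymptotic volume ratio `θ`
(CPAM 76 (2023), Thm. 1.1: `∫_D |∇f| + ∫_{∂D} f ≥ n |Bⁿ|^{1/n} θ^{1/n} (∫_D f^{n/(n-1)})^{(n-1)/n}` for
positive smooth `f` on a compact domain `D`; for `φ ∈ C_c^∞` take `D ⊃ supp φ` and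
`f = (φ² + δ²)^{1/2}`, `δ → 0⁺`: `q = n/(n-1)`, `C = n |Bⁿ|^{1/n} θ^{1/n}`), equivalently the sharp
isoperimetric inequality (Balogh–Kristály, Math. Ann. 385 (2023), Thm. 1.1 and the remark after
(1.2)). We PROVE that then every smooth compactly supported `u` satisfies, for all levels
`0 ≤ t₁ < t₂`, the **level bound**

  `C · μ{t₂ ≤ |u|}^{1/q} · (t₂ − t₁) ≤ ∫_{t₁ < |u| < t₂} |∇u|_g dμ`,

which is the form in which isoperimetry enters the discretised Pólya–Szegő inequality
(`Literature.Analysis.FunctionSpaces.exists_lipschitz_discretePolyaSzego_four_of_levelBound`) —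
with no coarea formula, no Minkowski content and no regularity of level sets: apply the Sobolev
inequality to the smooth truncation `φ = G ∘ u`, `G(s) = ℊ(|s|)` with `ℊ` a smooth monotone ramp,
`ℊ = 0` below `t₁`, `ℊ` constant `= L ≥ t₂ − t₁ − 4η` above `t₂`, `0 ≤ ℊ' ≤ 𝟙_{(t₁,t₂)}`
(a primitive of a bump function); then `|∇φ| = |ℊ'(|u|)| |∇u| ≤ 𝟙_{t₁<|u|<t₂} |∇u|` and
`|φ| = L` on `{|u| ≥ t₂}`, so `C L μ{t₂ ≤ |u|}^{1/q} ≤ C ‖φ‖_q ≤ ∫_{t₁<|u|<t₂} |∇u|`, and `η → 0`.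

* `exists_smooth_ramp` — the ramp `ℊ`;
* `levelBound_of_l1Sobolev` — **the level bound** (main theorem).

Everything is proved; no definitions, no named facts.

## References

* [Brendle2022] S. Brendle, *Sobolev inequalities in manifolds with nonnegative curvature*, Comm.
  Pure Appl. Math. 76 (2023) 2192–2218 (arXiv:2009.13717), Thm. 1.1 (p. 2 of the arXiv text). READ.
* [BaloghKristaly2022] Z. M. Balogh, A. Kristály, Math. Ann. 385 (2023) 1747–1773
  (arXiv:2012.11862), Thm. 1.1 and p. 4 ("equivalent to a sharp `L¹`-Sobolev inequality"). READ.
* G. Talenti, *Best constant in Sobolev inequality*, Ann. Mat. Pura Appl. 110 (1976) (truncation).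
-/

noncomputable section

open Bundle Set Function Filter Manifold MeasureTheory Metric
open scoped Manifold ContDiff Topology ENNReal NNReal

namespace Literature.Geometry.Riemannian

open Lorentzian

/-! ### A smooth monotone ramp -/

/-- **A smooth ramp.** For `η > 0` with `4η < b − a` there are smooth `ℊ, χ : ℝ → ℝ` with
`ℊ' = χ`, `0 ≤ χ ≤ 1`, `χ = 0` off `(a + η, b − η)`, `ℊ = 0` on `(-∞, a + η]`, `ℊ = ℊ(b)` on
`[b − η, ∞)`, `0 ≤ ℊ ≤ ℊ(b)` and `ℊ(b) ≥ b − a − 4η`: the primitive `ℊ(s) = ∫_a^s χ` of a bump `χ`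
with plateau `[a + 2η, b − 2η]` supported in `(a + η, b − η)`. [folklore] -/
theorem exists_smooth_ramp {a b η : ℝ} (hη : 0 < η) (hab : 4 * η < b - a) :
    ∃ (ℊ χ : ℝ → ℝ), ContDiff ℝ ∞ ℊ ∧ (∀ s, HasDerivAt ℊ (χ s) s) ∧ (∀ s, 0 ≤ χ s) ∧
      (∀ s, χ s ≤ 1) ∧ (∀ s, χ s ≠ 0 → a + η < s ∧ s < b - η) ∧ (∀ s, s ≤ a + η → ℊ s = 0) ∧
      (∀ s, b - η ≤ s → ℊ s = ℊ b) ∧ b - a - 4 * η ≤ ℊ b ∧ (∀ s, 0 ≤ ℊ s) ∧ (∀ s, ℊ s ≤ ℊ b) := by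
  -- the bump
  obtain ⟨m, hm⟩ : ∃ m : ℝ, m = (a + b) / 2 := ⟨_, rfl⟩
  obtain ⟨rI, hrI⟩ : ∃ r : ℝ, r = (b - a) / 2 - 2 * η := ⟨_, rfl⟩
  obtain ⟨rO, hrO⟩ : ∃ r : ℝ, r = (b - a) / 2 - η := ⟨_, rfl⟩
  have hrIn : 0 < rI := by rw [hrI]; linarith
  have hrlt : rI < rO := by rw [hrI, hrO]; linarith
  let B : ContDiffBump m := ⟨rI, rO, hrIn, hrlt⟩
  have hBrIn : B.rIn = rI := rfl
  have hBrOut : B.rOut = rO := rfl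
  obtain ⟨χ, hχ⟩ : ∃ χ : ℝ → ℝ, χ = B := ⟨_, rfl⟩
  have hχc : ContDiff ℝ ∞ χ := hχ ▸ B.contDiff
  have hχ0 : ∀ s, 0 ≤ χ s := fun s ↦ by rw [hχ]; exact B.nonneg
  have hχ1 : ∀ s, χ s ≤ 1 := fun s ↦ by rw [hχ]; exact B.le_one
  have hχsupp : ∀ s, χ s ≠ 0 → a + η < s ∧ s < b - η := by
    intro s hs
    have hmem : s ∈ Function.support (B : ℝ → ℝ) := by rw [← hχ]; exact hs
    rw [B.support_eq, hBrOut, Metric.mem_ball, Real.dist_eq, abs_lt] at hmem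
    constructor <;> linarith [hmem.1, hmem.2]
  have hχone : ∀ s, a + 2 * η ≤ s → s ≤ b - 2 * η → χ s = 1 := by
    intro s h1 h2
    rw [hχ]
    apply B.one_of_mem_closedBall
    rw [Metric.mem_closedBall, hBrIn, Real.dist_eq, abs_le]
    constructor <;> linarith
  have hχcont : Continuous χ := hχc.continuous
  have hχint : ∀ x y : ℝ, IntervalIntegrable χ volume x y := fun x y ↦
    hχcont.intervalIntegrable x y
  -- the primitive
  set ℊ : ℝ → ℝ := fun s ↦ ∫ r in a..s, χ r with hℊ
  have hderiv : ∀ s, HasDerivAt ℊ (χ s) s := fun s ↦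
    intervalIntegral.integral_hasDerivAt_right (hχint a s)
      (hχcont.stronglyMeasurableAtFilter _ _) hχcont.continuousAt
  have hdiff : Differentiable ℝ ℊ := fun s ↦ (hderiv s).differentiableAt
  have hderiv_eq : deriv ℊ = χ := funext fun s ↦ (hderiv s).deriv
  have hsmooth : ContDiff ℝ ∞ ℊ := by
    rw [contDiff_infty_iff_deriv]
    exact ⟨hdiff, by rw [hderiv_eq]; exact hχc⟩
  -- monotonicity and values
  have hmono : Monotone ℊ := monotone_of_deriv_nonneg hdiff (fun s ↦ by rw [hderiv_eq]; exact hχ0 s)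
  have hzero : ∀ s, s ≤ a + η → ℊ s = 0 := by
    intro s hs
    simp only [hℊ]
    apply intervalIntegral.integral_zero_ae
    refine ae_of_all _ fun r hr ↦ ?_
    by_contra hne
    have h := hχsupp r hne
    rcases le_or_gt a s with has | has
    · rw [uIoc_of_le has] at hr
      linarith [hr.2, h.1]
    · rw [uIoc_of_ge has.le] at hr
      linarith [hr.1, h.1, hr.2]
  have hconst : ∀ s, b - η ≤ s → ℊ s = ℊ b := by
    intro s hs
    -- `ℊ' = χ = 0` on `[b - η, ∞)`, so `ℊ` is constant there
    have key : ∀ x, b - η ≤ x → ℊ x = ℊ (b - η) := by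
      intro x hx
      simp only [hℊ]
      rw [← intervalIntegral.integral_add_adjacent_intervals (hχint a (b - η)) (hχint (b - η) x)]
      have : ∫ r in (b - η)..x, χ r = 0 := by
        apply intervalIntegral.integral_zero_ae
        refine ae_of_all _ fun r hr ↦ ?_
        by_contra hne
        have h := hχsupp r hne
        rw [uIoc_of_le hx] at hr
        linarith [hr.1, h.2]
      rw [this, add_zero]
    rw [key s hs, key b (by linarith)]
  have hlow : b - a - 4 * η ≤ ℊ b := by
    have h1 : ℊ (b - 2 * η) - ℊ (a + 2 * η) = ∫ r in (a + 2 * η)..(b - 2 * η), χ r := by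
      simp only [hℊ]
      rw [intervalIntegral.integral_interval_sub_left (hχint _ _) (hχint _ _)]
    have h2 : ∫ r in (a + 2 * η)..(b - 2 * η), χ r = ∫ r in (a + 2 * η)..(b - 2 * η), (1 : ℝ) := by
      apply intervalIntegral.integral_congr
      intro r hr
      rw [uIcc_of_le (by linarith)] at hr
      exact hχone r hr.1 hr.2
    rw [h2, intervalIntegral.integral_const, smul_eq_mul, mul_one] at h1
    have h3 : 0 ≤ ℊ (a + 2 * η) := by
      rw [← hzero (a + η) le_rfl]
      exact hmono (by linarith)
    have h4 : ℊ (b - 2 * η) ≤ ℊ b := hmono (by linarith)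
    linarith
  have hnonneg : ∀ s, 0 ≤ ℊ s := by
    intro s
    rcases le_or_gt s (a + η) with hs | hs
    · rw [hzero s hs]
    · rw [← hzero (a + η) le_rfl]; exact hmono hs.le
  have hle : ∀ s, ℊ s ≤ ℊ b := by
    intro s
    rcases le_or_gt s b with hs | hs
    · exact hmono hs
    · rw [hconst s (by linarith)]
  exact ⟨ℊ, χ, hsmooth, hderiv, hχ0, hχ1, hχsupp, hzero, hconst, hlow, hnonneg, hle⟩

/-! ### The level bound -/

section LevelBound

variable {E : Type*} [NormedAddCommGroup E] [NormedSpace ℝ E] [FiniteDimensional ℝ E]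
  {H : Type*} [TopologicalSpace H] {I : ModelWithCorners ℝ E H} [I.Boundaryless]
  {M : Type*} [TopologicalSpace M] [ChartedSpace H M] [IsManifold I ∞ M]
  (g : PseudoRiemannianMetric I ∞ E (TangentSpace I : M → Type _))

/-- **The level bound from the `L¹`-Sobolev inequality.** Let `(M, g)` be a Riemannian manifold on
which `C (∫ |φ|^q dμ)^{1/q} ≤ ∫ |∇φ|_g dμ` holds for all smooth compactly supported `φ` (`q > 0`,
`μ` the Riemannian measure). Then for every smooth compactly supported `u` and all `0 ≤ t₁ < t₂`,
`C · μ{t₂ ≤ |u|}^{1/q} · (t₂ − t₁) ≤ ∫_{t₁ < |u| < t₂} |∇u|_g dμ` — the Sobolev inequality applied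
to the smooth truncations `ℊ(|u|)` of `exists_smooth_ramp` (see the module docstring). With
Brendle's Thm. 1.1 (`q = n/(n−1)`, `C = n |Bⁿ|^{1/n} θ^{1/n}`) this is the input of the discretised
Pólya–Szegő inequality. [cite: Brendle2022, Thm. 1.1] [cite: BaloghKristaly2022, Thm. 1.1] -/
theorem levelBound_of_l1Sobolev [T3Space M] [SecondCountableTopology M] [T2Space M]
    [MeasurableSpace M] [BorelSpace M] (hg : g.IsRiemannian) {C q : ℝ} (hC : 0 ≤ C) (hq : 0 < q)
    (HS : ∀ φ : M → ℝ, ContMDiff I 𝓘(ℝ, ℝ) ∞ φ → HasCompactSupport φ →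
      C * (∫ x, |φ x| ^ q ∂(riemannianMeasure (g.toContMDiffRiemannianMetric hg))) ^ (1 / q) ≤
        ∫ x, Real.sqrt (g.gradSq φ x) ∂(riemannianMeasure (g.toContMDiffRiemannianMetric hg)))
    {u : M → ℝ} (hu : ContMDiff I 𝓘(ℝ, ℝ) ∞ u) (hcu : HasCompactSupport u)
    {t₁ t₂ : ℝ} (ht₁ : 0 ≤ t₁) (h12 : t₁ < t₂) :
    C * ((riemannianMeasure (g.toContMDiffRiemannianMetric hg)) {x | t₂ ≤ |u x|}).toReal ^ (1 / q) *
        (t₂ - t₁) ≤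
      ∫ x in {x | t₁ < |u x| ∧ |u x| < t₂}, Real.sqrt (g.gradSq u x)
        ∂(riemannianMeasure (g.toContMDiffRiemannianMetric hg)) := by
  set μ : Measure M := riemannianMeasure (g.toContMDiffRiemannianMetric hg) with hμ
  haveI : LocallyCompactSpace M := Manifold.locallyCompact_of_finiteDimensional I
  haveI : IsFiniteMeasureOnCompacts μ :=
    ⟨fun K hK ↦ riemannianVolume_lt_top_of_isCompact_holds _ le_rfl hK⟩
  have huc : Continuous u := hu.continuous
  have hu1 : ∀ x, MDifferentiableAt I 𝓘(ℝ, ℝ) u x := fun x ↦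
    (hu.of_le (WithTop.coe_le_coe.2 le_top) : ContMDiff I 𝓘(ℝ, ℝ) 1 u).mdifferentiableAt
      one_ne_zero
  have hg0 : ∀ x, 0 ≤ g.gradSq u x := g.gradSq_nonneg hg u
  set ρ : M → ℝ := fun x ↦ Real.sqrt (g.gradSq u x) with hρ
  have hρc : Continuous ρ := Real.continuous_sqrt.comp (contMDiff_gradSq g hu).continuous
  have hρ0 : ∀ x, 0 ≤ ρ x := fun x ↦ Real.sqrt_nonneg _
  have hgsupp : HasCompactSupport (g.gradSq u) := by
    refine hcu.mono' fun x hx ↦ ?_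
    by_contra hx'
    apply hx
    have hux : u =ᶠ[𝓝 x] fun _ ↦ (0 : ℝ) := notMem_tsupport_iff_eventuallyEq.1 hx'
    have h1 : mfderiv I 𝓘(ℝ, ℝ) u x = 0 := by rw [hux.mfderiv_eq]; exact mfderiv_const
    have hd : mvfderiv I u x = 0 := by simp only [mvfderiv, h1, ContinuousLinearMap.comp_zero]
    simp [PseudoRiemannianMetric.gradSq, PseudoRiemannianMetric.innerDual, hd]
  have hρs : HasCompactSupport ρ := by
    refine hgsupp.mono fun x hx ↦ ?_
    rw [Function.mem_support] at hx ⊢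
    intro h0
    apply hx
    show Real.sqrt (g.gradSq u x) = 0
    rw [h0, Real.sqrt_zero]
  have hρi : Integrable ρ μ := hρc.integrable_of_hasCompactSupport hρs
  -- finiteness of the superlevel set
  set m : ℝ := (μ {x | t₂ ≤ |u x|}).toReal with hm
  have hm0 : 0 ≤ m := ENNReal.toReal_nonneg
  have ht₂ : 0 < t₂ := lt_of_le_of_lt ht₁ h12
  have hsub : {x | t₂ ≤ |u x|} ⊆ tsupport u := fun x (hx : t₂ ≤ |u x|) ↦
    subset_tsupport u (Function.mem_support.2 (abs_pos.1 (lt_of_lt_of_le ht₂ hx)))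
  have hfin : μ {x | t₂ ≤ |u x|} ≠ ⊤ :=
    (lt_of_le_of_lt (measure_mono hsub) (hcu.isCompact.measure_lt_top (μ := μ))).ne
  have hmeas : MeasurableSet {x | t₂ ≤ |u x|} :=
    measurableSet_le measurable_const huc.measurable.abs
  -- the slab integral
  set S : Set M := {x | t₁ < |u x| ∧ |u x| < t₂} with hS
  have hSm : MeasurableSet S :=
    (measurableSet_lt measurable_const huc.measurable.abs).inter
      (measurableSet_lt huc.measurable.abs measurable_const)
  set R : ℝ := ∫ x in S, ρ x ∂μ with hR
  -- reduce to `η`-approximate statements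
  suffices key : ∀ η : ℝ, 0 < η → 4 * η < t₂ - t₁ →
      C * m ^ (1 / q) * (t₂ - t₁ - 4 * η) ≤ R by
    have hCm : 0 ≤ C * m ^ (1 / q) := mul_nonneg hC (Real.rpow_nonneg hm0 _)
    refine le_of_forall_pos_le_add fun ε hε ↦ ?_
    -- choose `η` with `4 η C m^{1/q} ≤ ε` and `4η < t₂ - t₁`
    obtain ⟨η, hη0, hη1, hη2⟩ : ∃ η : ℝ, 0 < η ∧ 4 * η < t₂ - t₁ ∧
        C * m ^ (1 / q) * (4 * η) ≤ ε := by
      refine ⟨min ((t₂ - t₁) / 8) (ε / (4 * (C * m ^ (1 / q) + 1))), ?_, ?_, ?_⟩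
      · positivity
      · have : min ((t₂ - t₁) / 8) (ε / (4 * (C * m ^ (1 / q) + 1))) ≤ (t₂ - t₁) / 8 :=
          min_le_left _ _
        linarith
      · have h1 : min ((t₂ - t₁) / 8) (ε / (4 * (C * m ^ (1 / q) + 1))) ≤
            ε / (4 * (C * m ^ (1 / q) + 1)) := min_le_right _ _
        calc C * m ^ (1 / q) * (4 * min ((t₂ - t₁) / 8) (ε / (4 * (C * m ^ (1 / q) + 1))))
            ≤ C * m ^ (1 / q) * (4 * (ε / (4 * (C * m ^ (1 / q) + 1)))) := by gcongr
          _ = ε * (C * m ^ (1 / q) / (C * m ^ (1 / q) + 1)) := by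
              field_simp
          _ ≤ ε * 1 := by
              gcongr
              rw [div_le_one (by positivity)]
              linarith
          _ = ε := mul_one _
    have h := key η hη0 hη1
    have : C * m ^ (1 / q) * (t₂ - t₁) = C * m ^ (1 / q) * (t₂ - t₁ - 4 * η) +
        C * m ^ (1 / q) * (4 * η) := by ring
    rw [this]
    linarith
  intro η hη hη4
  -- the ramp between `a = t₁` and `b = t₂`
  obtain ⟨ℊ, χ, hℊs, hℊd, hχ0, hχ1, hχsupp, hℊ0, hℊc, hℊlow, hℊnn, hℊle⟩ :=
    exists_smooth_ramp (a := t₁) (b := t₂) hη hη4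
  set L : ℝ := ℊ t₂ with hL
  have hL0 : 0 ≤ L := hℊnn t₂
  -- the symmetrised ramp `G s = ℊ s + ℊ (-s) = ℊ |s|`
  set G : ℝ → ℝ := fun s ↦ ℊ s + ℊ (-s) with hG
  have hGs : ContDiff ℝ ∞ G := hℊs.add (hℊs.comp contDiff_neg)
  have hGabs : ∀ s, G s = ℊ |s| := by
    intro s
    rcases le_or_gt 0 s with hs | hs
    · simp only [hG]
      rw [abs_of_nonneg hs, hℊ0 (-s) (by linarith), add_zero]
    · simp only [hG]
      rw [abs_of_neg hs, hℊ0 s (by linarith), zero_add]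
  have hGd : ∀ s, HasDerivAt G (χ s - χ (-s)) s := by
    intro s
    have h1 := hℊd s
    have h2 : HasDerivAt (fun s ↦ ℊ (-s)) (-(χ (-s))) s := by
      have h := (hℊd (-s)).comp s (hasDerivAt_neg' s)
      have e : χ (-s) * -1 = -(χ (-s)) := by ring
      rw [e] at h
      exact h
    have h3 := h1.add h2
    rw [← sub_eq_add_neg] at h3
    exact h3
  have hGd_abs : ∀ s, |χ s - χ (-s)| ≤ 1 := by
    intro s
    rw [abs_le]
    constructor <;> linarith [hχ0 s, hχ1 s, hχ0 (-s), hχ1 (-s)]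
  have hGd_zero : ∀ s, ¬ (t₁ < |s| ∧ |s| < t₂) → χ s - χ (-s) = 0 := by
    intro s hs
    have h1 : χ s = 0 := by
      by_contra hne
      have h := hχsupp s hne
      exact hs ⟨by rw [abs_of_pos (by linarith [h.1])]; linarith [h.1],
        by rw [abs_of_pos (by linarith [h.1])]; linarith [h.2]⟩
    have h2 : χ (-s) = 0 := by
      by_contra hne
      have h := hχsupp (-s) hne
      exact hs ⟨by rw [abs_of_neg (by linarith [h.1])]; linarith [h.1],
        by rw [abs_of_neg (by linarith [h.1])]; linarith [h.2]⟩
    rw [h1, h2, sub_zero]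
  -- the test function `φ = G ∘ u`
  set φ : M → ℝ := G ∘ u with hφ
  have hφs : ContMDiff I 𝓘(ℝ, ℝ) ∞ φ := hGs.contMDiff.comp hu
  have hG00 : G 0 = 0 := by rw [hGabs, abs_zero, hℊ0 0 (by linarith)]
  have hφsupp : HasCompactSupport φ := by
    refine hcu.mono fun x hx ↦ ?_
    rw [Function.mem_support] at hx ⊢
    intro hu0
    apply hx
    show G (u x) = 0
    rw [hu0, hG00]
  -- its gradient: `|∇φ| = |G'(u)| |∇u| ≤ 𝟙_S |∇u|`
  have hgradφ : ∀ x, g.gradSq φ x = (χ (u x) - χ (-u x)) ^ 2 * g.gradSq u x := by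
    intro x
    have hd : mvfderiv I φ x = (χ (u x) - χ (-u x)) • mvfderiv I u x := by
      ext v
      rw [hφ, PseudoRiemannianMetric.mvfderiv_real_comp (hGd (u x)).differentiableAt (hu1 x) v,
        (hGd (u x)).deriv]
      rfl
    simp only [PseudoRiemannianMetric.gradSq, PseudoRiemannianMetric.innerDual, hd,
      ContinuousLinearMap.toLinearMap_smul, map_smul, LinearMap.smul_apply, smul_eq_mul]
    ring
  have hsqrtφ : ∀ x, Real.sqrt (g.gradSq φ x) = |χ (u x) - χ (-u x)| * ρ x := by
    intro x
    rw [hgradφ, Real.sqrt_mul' _ (hg0 x), Real.sqrt_sq_eq_abs]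
  have hbound : ∀ x, Real.sqrt (g.gradSq φ x) ≤ S.indicator ρ x := by
    intro x
    rw [hsqrtφ]
    by_cases hx : x ∈ S
    · rw [indicator_of_mem hx]
      calc |χ (u x) - χ (-u x)| * ρ x ≤ 1 * ρ x :=
            mul_le_mul_of_nonneg_right (hGd_abs _) (hρ0 x)
        _ = ρ x := one_mul _
    · rw [indicator_of_notMem hx, hGd_zero (u x) hx, abs_zero, zero_mul]
  -- the Sobolev inequality for `φ`
  have hHS := HS φ hφs hφsupp
  -- upper bound of the right-hand side by the slab integral
  have hupper : ∫ x, Real.sqrt (g.gradSq φ x) ∂μ ≤ R := by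
    have hint : Integrable (S.indicator ρ) μ := (hρi.indicator hSm)
    calc ∫ x, Real.sqrt (g.gradSq φ x) ∂μ ≤ ∫ x, S.indicator ρ x ∂μ := by
          refine integral_mono_of_nonneg (ae_of_all _ fun x ↦ Real.sqrt_nonneg _) hint
            (ae_of_all _ hbound)
      _ = R := by rw [hR, integral_indicator hSm]
  -- lower bound of the left-hand side: `L m^{1/q} ≤ ‖φ‖_q`
  have hφabs : ∀ x, |φ x| = ℊ |u x| := by
    intro x
    show |G (u x)| = ℊ |u x|
    rw [hGabs, abs_of_nonneg (hℊnn _)]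
  have hφq_int : Integrable (fun x ↦ |φ x| ^ q) μ := by
    refine Continuous.integrable_of_hasCompactSupport ?_ ?_
    · exact (continuous_abs.comp (hGs.continuous.comp huc)).rpow_const fun x ↦ Or.inr hq.le
    · refine hφsupp.norm.mono fun x hx ↦ ?_
      rw [Function.mem_support] at hx ⊢
      contrapose! hx
      rw [Real.norm_eq_abs] at hx
      rw [hx, Real.zero_rpow hq.ne']
  have hlowerInt : L ^ q * m ≤ ∫ x, |φ x| ^ q ∂μ := by
    have h1 : ∫ x, {x | t₂ ≤ |u x|}.indicator (fun _ ↦ L ^ q) x ∂μ = L ^ q * m := by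
      rw [integral_indicator_const _ hmeas, smul_eq_mul, hm, measureReal_def, mul_comm]
    rw [← h1]
    refine integral_mono_of_nonneg
      (ae_of_all _ (indicator_nonneg fun x _ ↦ by positivity)) hφq_int (ae_of_all _ fun x ↦ ?_)
    · by_cases hx : x ∈ {x | t₂ ≤ |u x|}
      · rw [indicator_of_mem hx]
        dsimp only
        rw [hφabs]
        have hx' : t₂ ≤ |u x| := hx
        have hval : ℊ |u x| = L := hℊc _ (by linarith)
        rw [hval]
      · rw [indicator_of_notMem hx]
        dsimp only
        positivity
  have hlower : L * m ^ (1 / q) ≤ (∫ x, |φ x| ^ q ∂μ) ^ (1 / q) := by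
    have h1 : (L ^ q * m) ^ (1 / q) = L * m ^ (1 / q) := by
      rw [Real.mul_rpow (Real.rpow_nonneg hL0 _) hm0, ← Real.rpow_mul hL0,
        mul_one_div_cancel hq.ne', Real.rpow_one]
    rw [← h1]
    exact Real.rpow_le_rpow (by positivity) hlowerInt (by positivity)
  -- assemble
  calc C * m ^ (1 / q) * (t₂ - t₁ - 4 * η) ≤ C * m ^ (1 / q) * L := by
        have : 0 ≤ C * m ^ (1 / q) := mul_nonneg hC (Real.rpow_nonneg hm0 _)
        exact mul_le_mul_of_nonneg_left hℊlow this
    _ = C * (L * m ^ (1 / q)) := by ring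
    _ ≤ C * (∫ x, |φ x| ^ q ∂μ) ^ (1 / q) := mul_le_mul_of_nonneg_left hlower hC
    _ ≤ ∫ x, Real.sqrt (g.gradSq φ x) ∂μ := hHS
    _ ≤ R := hupper

end LevelBound

end Literature.Geometry.Riemannian

end
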